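import Summits.CriticalPhenomena.SAWScalingLimit.Theorems.SAWDevelopingMapObservableToSLETypeLadderCarvedReductionSqueezeFinalA
import Summits.CriticalPhenomena.SAWScalingLimit.Theorems.SAWDevelopingMapObservableToSLETypeLadderCarvedReductionSqueezePkgExtract
import Summits.CriticalPhenomena.SAWScalingLimit.Theorems.SAWDevelopingMapObservableToSLETypeLadderCarvedReductionSqueezeLimitExtract
import Summits.CriticalPhenomena.SAWScalingLimit.Theorems.SAWDevelopingMapObservableToSLETypeLadderCarvedReductionSqueezeEnvelopeData
import Summits.CriticalPhenomena.SAWScalingLimit.Theorems.SAWDevelopingMapObservableToSLETypeLadderCarvedReductionSqueezeConfinedOuterHull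
import Summits.CriticalPhenomena.SAWScalingLimit.Theorems.SAWDefectDecoherenceObservableToSLERCarvedReductionSqueezeInnerParam
import Summits.CriticalPhenomena.SAWScalingLimit.Theorems.SAWDefectDecoherenceObservableToSLERCarvedReductionSqueezeFingers
import HarnessLib

/-!
# T-A′₂F `stub_carvedReduction_squeezeGeometry_domainsCoreF`: the continuum geometry of the
# squeeze (crux `SAWDevelopingMap.ObservableToSLE`, line `six-class-type-ladder`)

Crux `SAWDevelopingMap.ObservableToSLE` (stmt-CriticalPhenomena-10472), line `six-class-type-ladder`,
stub T-A′₂F `stub_carvedReduction_squeezeGeometry_domainsCoreF`.  Landing target: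
`Summits/CriticalPhenomena/SAWScalingLimit/Theorems/SAWDevelopingMapObservableToSLETypeLadderCarvedReductionSqueezeDomainsCoreF.lean`.

`carvedReduction_squeezeGeometry_domainsCoreF` is the registered statement of T-A′₂F byte for
byte (its hypothesis T-A′₁ `stub_carvedReduction_confinedOuterHull` is landed and used through
`outerStep`): from the hypotheses of T-A and the output of STAGE 1a along a subsequence, a further
subsequence with the outer approximant `E = E_{n₀}`, the inner approximant `M`, the restriction
datum and the 35 clauses of STAGE 2′.  ASSEMBLY ONLY: D-level constants
(`stub_carvedReduction_envelopeData`, `Squeeze.stub_carvedReduction_paramModulus`,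
`Squeeze.noLongFingers_domain`), `ρ ≤ R` (`rho_le_R`), the limit data (`squeezePkg_extract`,
`squeezeLimit_extract`), its outer data (`SqueezeLimit.outer`), the final pair
(`SqueezeLimit.final_pair`), and the pass-through clauses.
Registered carrier: `stub_carvedReduction_domainsCoreF`.
-/

noncomputable section

open scoped BigOperators Topology NNReal ENNReal Classical
open Filter Set MeasureTheory Metric
open Literature.Probability.LatticeModels (HexVertex hexGraph hexCenter triZeta triEmbed Site polyline)
open Literature.Probability.RandomPlanarGeometry
open Literature.Probability.RandomPlanarGeometry.SAW
open UpperHalfPlane (upperHalfPlaneSet)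
open ComplexConjugate

namespace Summit.CriticalPhenomena.SAWScalingLimit.Theorems.ObservableToSLE.TypeLadder

open Summit.CriticalPhenomena.SAWScalingLimit.Theorems.ObservableToSLER.BridgeGate
open Summit.CriticalPhenomena.SAWScalingLimit.Theorems.ObservableToSLER.NestedGate
open Summit.CriticalPhenomena.SAWScalingLimit.Theorems.ObservableToSLER.Squeeze (stub_carvedReduction_paramModulus noLongFingers_domain)

/-- **T-A′₂F `stub_carvedReduction_squeezeGeometry_domainsCoreF`** (registered statement, byte for
byte); see the module docstring. -/
theorem carvedReduction_squeezeGeometry_domainsCoreF :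
    (∀ (D : DobrushinDomain) (φ : ConformalEquiv upperHalfPlaneSet D.carrier) (A B W : Set ℂ) (r Rb θ : ℝ),
      D.IsChordalUniformizing φ → IsStarHull A → IsStarHull B → 0 < r → 0 ≤ Rb → 0 < θ →
      (∀ w ∈ B, r ≤ infDist w (closure (upperHalfPlaneSet \ A))) →
      IsOpen W → B ⊆ W → B ⊆ closedBall 0 Rb →
      ∃ D'' : DobrushinDomain, D.IsHullSubdomain D'' ∧
        (∀ w ∈ upperHalfPlaneSet, infDist w (closure (upperHalfPlaneSet \ A)) ≤ r / 4 → φ w ∈ D''.carrier) ∧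
        (∀ w ∈ upperHalfPlaneSet, w ∉ W → (θ ≤ w.im ∨ Rb + 1 ≤ |w.re|) → φ w ∈ D''.carrier) ∧
        B ⊆ φ.pullbackHull D'' ∧ φ.pullbackHull D'' ⊆ A ∧
        (∀ w ∈ φ.pullbackHull D'', r / 4 ≤ infDist w (closure (upperHalfPlaneSet \ A)))) →
    (∀ (D : DobrushinDomain) (a b : ℝ → HexVertex), IsEmbEndpointApprox hexGraph hexCenter D a b →
      ∀ η > (0 : ℝ), ∃ R₀ > (0 : ℝ), ∀ R ∈ Set.Ioc (0 : ℝ) R₀, ∀ ρ > (0 : ℝ), ∀ N : ℕ,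
          ∀ (δ : ℕ → ℝ) (S T : ℕ → ℕ → Set HexVertex) (n n' : ℕ → ℕ) (q q' : ℕ → HexVertex),
            Tendsto δ atTop (𝓝[>] 0) →
            (∀ k, TameNestedFamily (δ k) R N (a (δ k)) (S k) ∧
              TameNestedFamily (δ k) R N (b (δ k)) (T k) ∧
              (((∀ i, ExteriorAnchored D.carrier (δ k) (S k i) (a (δ k))) ∧
          (∀ i, ExteriorAnchored D.carrier (δ k) (T k i) (b (δ k))) ∧
          (∀ (i : ℕ) (p q : HexVertex), HasCleanWindow D.carrier (δ k) ρ (S k i) p q →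
            rowOf 0 q = rowOf 0 p + 1 ∧
              ∀ x : HexVertex, ((δ k : ℝ) : ℂ) * hexCenter x ∈ ball (((δ k : ℝ) : ℂ) * hexCenter q) ρ →
                (x ∈ S k i ↔ rowOf 0 x ≤ rowOf 0 p)) ∧
          (∀ (i : ℕ) (p q : HexVertex), HasCleanWindow D.carrier (δ k) ρ (T k i) p q →
            rowOf 0 q = rowOf 0 p + 1 ∧
              ∀ x : HexVertex, ((δ k : ℝ) : ℂ) * hexCenter x ∈ ball (((δ k : ℝ) : ℂ) * hexCenter q) ρ →
                (x ∈ T k i ↔ rowOf 0 x ≤ rowOf 0 p))) ∧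
          (∀ (i : ℕ) (p q : HexVertex), HasCleanWindow D.carrier (δ k) ρ (S k i) p q →
            ∃ K : Set ℂ, IsCompact K ∧ IsConnected K ∧
              ((δ k : ℝ) : ℂ) * hexCenter q - ((ρ / 2 : ℝ) : ℂ) * Complex.I ∈ K ∧ ((δ k : ℝ) : ℂ) * hexCenter (a (δ k)) ∈ K ∧
              ∀ v : HexVertex, Metric.infDist (((δ k : ℝ) : ℂ) * hexCenter v) K ≤ ρ / 4 → v ∈ S k i) ∧
          (∀ (i : ℕ) (p q : HexVertex), HasCleanWindow D.carrier (δ k) ρ (T k i) p q →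
            ∃ K : Set ℂ, IsCompact K ∧ IsConnected K ∧
              ((δ k : ℝ) : ℂ) * hexCenter q - ((ρ / 2 : ℝ) : ℂ) * Complex.I ∈ K ∧ ((δ k : ℝ) : ℂ) * hexCenter (b (δ k)) ∈ K ∧
              ∀ v : HexVertex, Metric.infDist (((δ k : ℝ) : ℂ) * hexCenter v) K ≤ ρ / 4 → v ∈ T k i) ∧
          (∀ i : ℕ, ∃ K : Set ℂ, IsCompact K ∧ IsConnected K ∧ ((δ k : ℝ) : ℂ) * hexCenter (a (δ k)) ∈ K ∧
            (∀ v : HexVertex, Metric.infDist (((δ k : ℝ) : ℂ) * hexCenter v) K ≤ ρ / 8 → v ∈ S k i) ∧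
            (∀ v ∈ S k i, ∃ (t w : HexVertex) (r : ℕ), v ∈ hexBall t r ∧ w ∈ hexBall t r ∧
              hexBall t r ⊆ S k i ∧ Metric.infDist (((δ k : ℝ) : ℂ) * hexCenter w) K ≤ ρ / 16)) ∧
          (∀ i : ℕ, ∃ K : Set ℂ, IsCompact K ∧ IsConnected K ∧ ((δ k : ℝ) : ℂ) * hexCenter (b (δ k)) ∈ K ∧
            (∀ v : HexVertex, Metric.infDist (((δ k : ℝ) : ℂ) * hexCenter v) K ≤ ρ / 8 → v ∈ T k i) ∧
            (∀ v ∈ T k i, ∃ (t w : HexVertex) (r : ℕ), v ∈ hexBall t r ∧ w ∈ hexBall t r ∧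
              hexBall t r ⊆ T k i ∧ Metric.infDist (((δ k : ℝ) : ℂ) * hexCenter w) K ≤ ρ / 16)))) →
            (∀ k, ∃ (γ : HexDomainSAW D.carrier (δ k) (a (δ k)) (b (δ k))) (m : ℕ) (p : HexVertex)
                (m' : ℕ) (p' : HexVertex),
              IsFirstGoodGateN D.carrier (δ k) ρ R (S k) (a (δ k)) γ.walk.support (n k) m p (q k) ∧
              IsFirstGoodGateN D.carrier (δ k) ρ R (T k) (b (δ k)) γ.walk.support.reverse
                (n' k) m' p' (q' k) ∧
              WideLink D.carrier (δ k) ρ (S k (n k) ∪ T k (n' k)) (q k) (q' k)) →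
            ∀ ε' > (0 : ℝ), ∀ φ : ℕ → ℕ, StrictMono φ →
              ∀ (ψ₀ : ℕ → ℕ) (x : ℕ → Site 2) (τ P₀ P₁ : ℂ),
                StrictMono ψ₀ ∧ (StrictAnti fun j => δ (φ (ψ₀ j))) ∧ (∀ j, 0 < δ (φ (ψ₀ j))) ∧
                Tendsto (fun j => δ (φ (ψ₀ j))) atTop (𝓝[>] 0) ∧
                Tendsto (fun j => ((δ (φ (ψ₀ j)) : ℝ) : ℂ) * triEmbed (x j)) atTop (𝓝 τ) ∧
                (∀ k, (q k).2 = 0) ∧ (∀ k, (q' k).2 = 0) ∧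
                Tendsto (fun j => ((δ (φ (ψ₀ j)) : ℝ) : ℂ) *
                  hexCenter (((q (φ (ψ₀ j))).1 - x j, 0) : HexVertex)) atTop (𝓝 P₀) ∧
                Tendsto (fun j => ((δ (φ (ψ₀ j)) : ℝ) : ℂ) *
                  hexCenter (((q' (φ (ψ₀ j))).1 - x j, 0) : HexVertex)) atTop (𝓝 P₁) ∧
                (∀ j, P₀.im < (((δ (φ (ψ₀ j)) : ℝ) : ℂ) * hexCenter (((q (φ (ψ₀ j))).1 - x j, 0) : HexVertex)).im) ∧
                (∀ j, P₁.im < (((δ (φ (ψ₀ j)) : ℝ) : ℂ) * hexCenter (((q' (φ (ψ₀ j))).1 - x j, 0) : HexVertex)).im) ∧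
                Tendsto (fun j => ((δ (φ (ψ₀ j)) : ℝ) : ℂ) * hexCenter (q (φ (ψ₀ j)))) atTop (𝓝 (P₀ + τ)) ∧
                Tendsto (fun j => ((δ (φ (ψ₀ j)) : ℝ) : ℂ) * hexCenter (q' (φ (ψ₀ j)))) atTop (𝓝 (P₁ + τ)) ∧
                (∀ᶠ j in atTop, ∀ v : HexVertex,
                  ((δ (φ (ψ₀ j)) : ℝ) : ℂ) * hexCenter v - ((δ (φ (ψ₀ j)) : ℝ) : ℂ) * triEmbed (x j) ∈ ball P₀ (ρ / 2) →
                    (v ∈ S (φ (ψ₀ j)) (n (φ (ψ₀ j))) ∪ T (φ (ψ₀ j)) (n' (φ (ψ₀ j))) ↔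
                      v.1 1 < (q (φ (ψ₀ j))).1 1)) ∧
                (∀ᶠ j in atTop, ∀ v : HexVertex,
                  ((δ (φ (ψ₀ j)) : ℝ) : ℂ) * hexCenter v - ((δ (φ (ψ₀ j)) : ℝ) : ℂ) * triEmbed (x j) ∈ ball P₁ (ρ / 2) →
                    (v ∈ S (φ (ψ₀ j)) (n (φ (ψ₀ j))) ∪ T (φ (ψ₀ j)) (n' (φ (ψ₀ j))) ↔
                      v.1 1 < (q' (φ (ψ₀ j))).1 1)) ∧
                (∀ᶠ j in atTop,
                  closedBall (P₀ + ((δ (φ (ψ₀ j)) : ℝ) : ℂ) * triEmbed (x j)) (ρ / 2) ⊆ D.carrier ∧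
                  closedBall (P₁ + ((δ (φ (ψ₀ j)) : ℝ) : ℂ) * triEmbed (x j)) (ρ / 2) ⊆ D.carrier) ∧
                (∀ k, q k ∈ embMeshDomain hexGraph hexCenter D.carrier (δ k)) ∧
                (∀ᶠ k in atTop, IsProbabilityMeasure
                  (carvedLaw D.carrier (δ k) (S k (n k) ∪ T k (n' k)) (q k) (q' k))) →
              ∃ (ψ₀ : ℕ → ℕ) (E M : DobrushinDomain) (τ : ℂ) (x : ℕ → Site 2)
                (φE : ConformalEquiv upperHalfPlaneSet E.carrier)
                (Φ : ConformalEquiv (upperHalfPlaneSet \ φE.pullbackHull M) upperHalfPlaneSet) (d : ℝ)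
                (ρw ρc ρc' ρF : ℝ),
                (StrictMono ψ₀) ∧
                (StrictAnti fun j => δ (φ (ψ₀ j))) ∧
                (∀ j, 0 < δ (φ (ψ₀ j))) ∧
                (Tendsto (fun j => δ (φ (ψ₀ j))) atTop (𝓝[>] 0)) ∧
                (Tendsto (fun j => ((δ (φ (ψ₀ j)) : ℝ) : ℂ) * triEmbed (x j)) atTop (𝓝 τ)) ∧
                (E.IsHullSubdomain M) ∧
                (∀ t : ℝ, dist (M.boundary t + τ) (D.boundary t) ≤ η) ∧
                (dist (M.pt 0 + τ) (D.pt 0) ≤ η) ∧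
                (dist (M.pt 1 + τ) (D.pt 1) ≤ η) ∧
                (∀ i, E.carrier ∩ ball (E.pt i) ρw = {z : ℂ | (E.pt i).im < z.im} ∩ ball (E.pt i) ρw) ∧
                (∀ i (z : ℂ), |z.re - (E.pt i).re| ≤ ρc → (E.pt i).im - ρc' ≤ z.im → z.im ≤ (E.pt i).im → z ∉ E.carrier) ∧
                (0 < ρc) ∧
                (0 < ρc') ∧
                (0 < ρF) ∧
                (ρF ≤ ρc) ∧
                (ρF ≤ ρc') ∧
                (ρF ≤ ρw) ∧
                (2 * (ρc + ρc') + ρF ≤ dist (E.pt 0) (E.pt 1)) ∧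
                (E.IsChordalUniformizing φE) ∧
                (IsRestrictionMap (φE.pullbackHull M) Φ) ∧
                (HasRestrictionDeriv (φE.pullbackHull M) Φ d) ∧
                (1 - ε' < d ^ ((5 : ℝ) / 8)) ∧
                (∀ j, (q (φ (ψ₀ j))).2 = 0) ∧
                (∀ j, (q' (φ (ψ₀ j))).2 = 0) ∧
                (Tendsto (fun j => ((δ (φ (ψ₀ j)) : ℝ) : ℂ) * hexCenter (((q (φ (ψ₀ j))).1 - x j, 0) : HexVertex)) atTop (𝓝 (E.pt 0))) ∧
                (Tendsto (fun j => ((δ (φ (ψ₀ j)) : ℝ) : ℂ) * hexCenter (((q' (φ (ψ₀ j))).1 - x j, 0) : HexVertex)) atTop (𝓝 (E.pt 1))) ∧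
                (∀ j, (E.pt 0).im < (((δ (φ (ψ₀ j)) : ℝ) : ℂ) * hexCenter (((q (φ (ψ₀ j))).1 - x j, 0) : HexVertex)).im) ∧
                (∀ j, (E.pt 1).im < (((δ (φ (ψ₀ j)) : ℝ) : ℂ) * hexCenter (((q' (φ (ψ₀ j))).1 - x j, 0) : HexVertex)).im) ∧
                (∀ᶠ j in atTop, ∀ v : HexVertex, ((δ (φ (ψ₀ j)) : ℝ) : ℂ) * hexCenter v - ((δ (φ (ψ₀ j)) : ℝ) : ℂ) * triEmbed (x j) ∈ ball (E.pt 0) ρF → (v ∈ S (φ (ψ₀ j)) (n (φ (ψ₀ j))) ∪ T (φ (ψ₀ j)) (n' (φ (ψ₀ j))) ↔ v.1 1 < (q (φ (ψ₀ j))).1 1)) ∧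
                (∀ᶠ j in atTop, ∀ v : HexVertex, ((δ (φ (ψ₀ j)) : ℝ) : ℂ) * hexCenter v - ((δ (φ (ψ₀ j)) : ℝ) : ℂ) * triEmbed (x j) ∈ ball (E.pt 1) ρF → (v ∈ S (φ (ψ₀ j)) (n (φ (ψ₀ j))) ∪ T (φ (ψ₀ j)) (n' (φ (ψ₀ j))) ↔ v.1 1 < (q' (φ (ψ₀ j))).1 1)) ∧
                (∀ᶠ j in atTop, ∀ z : ℂ, (z ∈ M.carrier ∨ ∃ i, dist z (E.pt i) ≤ 2 * ρc) → z + ((δ (φ (ψ₀ j)) : ℝ) : ℂ) * triEmbed (x j) ∈ D.carrier) ∧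
                (∀ᶠ j in atTop, ∀ v : HexVertex, ((δ (φ (ψ₀ j)) : ℝ) : ℂ) * hexCenter v - ((δ (φ (ψ₀ j)) : ℝ) : ℂ) * triEmbed (x j) ∈ M.carrier → (∀ i, ρF ≤ dist (((δ (φ (ψ₀ j)) : ℝ) : ℂ) * hexCenter v - ((δ (φ (ψ₀ j)) : ℝ) : ℂ) * triEmbed (x j)) (E.pt i)) → v ∉ S (φ (ψ₀ j)) (n (φ (ψ₀ j))) ∪ T (φ (ψ₀ j)) (n' (φ (ψ₀ j)))) ∧
                (∀ᶠ j in atTop, ∀ (w : HexVertex) (π : (hexDomainGraph D.carrier (δ (φ (ψ₀ j)))).Walk (q (φ (ψ₀ j))) w), (∀ y ∈ π.support, y ∉ S (φ (ψ₀ j)) (n (φ (ψ₀ j))) ∪ T (φ (ψ₀ j)) (n' (φ (ψ₀ j)))) → ∀ y ∈ π.support, ((δ (φ (ψ₀ j)) : ℝ) : ℂ) * hexCenter y - ((δ (φ (ψ₀ j)) : ℝ) : ℂ) * triEmbed (x j) ∈ E.carrier ∧ closedBall (((δ (φ (ψ₀ j)) : ℝ) : ℂ) * hexCenter y - ((δ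 (φ (ψ₀ j)) : ℝ) : ℂ) * triEmbed (x j)) (25 * δ (φ (ψ₀ j))) ⊆ E.carrier ∪ ⋃ i, {z : ℂ | |z.re - (E.pt i).re| ≤ ρc ∧ (E.pt i).im - 30 * δ (φ (ψ₀ j)) ≤ z.im ∧ z.im ≤ (E.pt i).im} ∧ (|(((δ (φ (ψ₀ j)) : ℝ) : ℂ) * hexCenter y - ((δ (φ (ψ₀ j)) : ℝ) : ℂ) * triEmbed (x j)).re - (E.pt 0).re| < ρc + 10 * δ (φ (ψ₀ j)) → |(((δ (φ (ψ₀ j)) : ℝ) : ℂ) * hexCenter y - ((δ (φ (ψ₀ j)) : ℝ) : ℂ) * triEmbed (x j)).im - (E.pt 0).im| < ρc' → (q (φ (ψ₀ j))).1 1 ≤ y.1 1) ∧ (|(((δ (φ (ψ₀ j)) : ℝ) : ℂ) * hexCenter y - ((δ (φ (ψ₀ j)) : ℝ) : ℂ) * triEmbed (x j)).re - (E.pt 1).re| < ρc + 10 * δ (φ (ψ₀ j)) → |(((δ (φ (ψ₀ j)) : ℝ) : ℂ) * hexCenter y - ((δ (φ (ψ₀ j)) : ℝ) : ℂ) * triEmbed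 (x j)).im - (E.pt 1).im| < ρc' → (q' (φ (ψ₀ j))).1 1 ≤ y.1 1)) ∧
                (∀ j, q (φ (ψ₀ j)) ∈ embMeshDomain hexGraph hexCenter D.carrier (δ (φ (ψ₀ j)))) ∧
                (∀ᶠ j in atTop, IsProbabilityMeasure (carvedLaw D.carrier (δ (φ (ψ₀ j))) (S (φ (ψ₀ j)) (n (φ (ψ₀ j))) ∪ T (φ (ψ₀ j)) (n' (φ (ψ₀ j)))) (q (φ (ψ₀ j))) (q' (φ (ψ₀ j)))))) := by
  intro _hconf D a b hab η hη
  -- D-level constants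
  obtain ⟨H, d, β, εD, -, -, hεD, hd1, -, hHd, hHball, hHcl, hcone, hexits⟩ := stub_carvedReduction_envelopeData D
  have h01 : D.pt 0 ≠ D.pt 1 := fun h => absurd (D.pt_injective h) (by decide)
  have hdist : 0 < dist (D.pt 0) (D.pt 1) := dist_pos.2 h01
  set η' : ℝ := min η (dist (D.pt 0) (D.pt 1)) with hη'
  have hη'0 : 0 < η' := lt_min hη hdist
  obtain ⟨sP, hsP, hab', hba', H1, r₀, hr₀, H2⟩ := stub_carvedReduction_paramModulus D (η' / 3) (by positivity)
  set rs : ℝ := min (η' / 6) (r₀ / 2) with hrs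
  have hrs0 : 0 < rs := lt_min (by positivity) (by positivity)
  -- the no-long-fingers region
  set u : ℝ → ℂ := fun t => if t = D.mark 0 then d 0 else d 1 with hu
  have hu1 : ∀ t, u t ∈ sphere (0 : ℂ) 1 := fun t => by
    show (if t = D.mark 0 then d 0 else d 1) ∈ sphere (0 : ℂ) 1
    split_ifs <;> simp [hd1]
  have hupt : ∀ i, D.pt i = H (u (D.mark i)) := by
    have hne : D.mark 1 ≠ D.mark 0 := (D.strictMono_mark (show (0 : Fin 2) < 1 by decide)).ne'
    refine Fin.forall_fin_two.2 ⟨?_, ?_⟩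
    · show D.pt 0 = H (if D.mark 0 = D.mark 0 then d 0 else d 1); simp [hHd]
    · show D.pt 1 = H (if D.mark 1 = D.mark 0 then d 0 else d 1); simp [hne, hHd]
  obtain ⟨δf, hδf, Uf', hUf'o, hUf'c, hUf'D, hUf'disj, hUf'big⟩ := noLongFingers_domain D H u hHball hu1 hupt hrs0
  refine ⟨min (min (εD / 2) (rs / 4)) (min δf (dist (D.pt 0) (D.pt 1) / 8)), by positivity, ?_⟩
  rintro R ⟨hR0, hRle⟩ ρ hρ N δ S T n n' q q' hδ hfam hgates ε' hε' φ hφ ψ₀ x τ P₀ P₁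
    ⟨hψ₀, hanti, hpos, hs0, hτ, hq2, hq2', hconv, hconv', habove, habove', hgate, hgate', hU, hU', hballs, hqdom, hprob⟩
  have hRε : R ≤ εD / 2 := hRle.trans ((min_le_left _ _).trans (min_le_left _ _))
  have hRrs : R ≤ rs / 4 := hRle.trans ((min_le_left _ _).trans (min_le_right _ _))
  have hRδ : R ≤ δf := hRle.trans ((min_le_right _ _).trans (min_le_left _ _))
  have hRd : R ≤ dist (D.pt 0) (D.pt 1) / 8 := hRle.trans ((min_le_right _ _).trans (min_le_right _ _))
  -- `ρ ≤ R` from the realised gates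
  have hs0' : Tendsto (fun j => δ (φ (ψ₀ j))) atTop (𝓝 0) := hs0.mono_right nhdsWithin_le_nhds
  have hgd : ∀ j, closedBall (((δ (φ (ψ₀ j)) : ℝ) : ℂ) * hexCenter (q (φ (ψ₀ j)))) ρ ⊆ D.carrier ∧
      dist (((δ (φ (ψ₀ j)) : ℝ) : ℂ) * hexCenter (q (φ (ψ₀ j)))) (((δ (φ (ψ₀ j)) : ℝ) : ℂ) * hexCenter (a (δ (φ (ψ₀ j))))) ≤
        R + δ (φ (ψ₀ j)) := by
    intro j
    obtain ⟨γ, m, p, m', p', hgS, -, -⟩ := hgates (φ (ψ₀ j))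
    exact ⟨hgS.1.2.2.1.1, dist_gate_root_le (hpos j).le γ.walk hgS (hfam _).1⟩
  have hρR : ρ ≤ R := rho_le_R (u := fun j => ((δ (φ (ψ₀ j)) : ℝ) : ℂ) * hexCenter (q (φ (ψ₀ j))))
    (v := fun j => ((δ (φ (ψ₀ j)) : ℝ) : ℂ) * hexCenter (a (δ (φ (ψ₀ j))))) hs0' (hab.tendsto_fst.comp hs0)
    (fun h => (D.pt_mem_frontier 0).2 (by rwa [D.isOpen.interior_eq])) (fun j => (hgd j).1) (fun j => (hgd j).2)
  have hsep : 2 * (R + ρ) < dist (D.pt 0) (D.pt 1) := by linarith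
  have hRεD : R + ρ ≤ εD := by linarith
  -- the limit data
  obtain ⟨θ, hθ, ⟨Pk⟩⟩ := squeezePkg_extract D a b hab hρ hfam hgates (κ₀ := fun j => φ (ψ₀ j)) hanti hpos hs0 hτ hconv hconv'
    habove habove' hgate hgate' hU hU' hballs (fun j => hqdom _) ((hφ.comp hψ₀).tendsto_atTop.eventually hprob)
  obtain ⟨Λ⟩ := squeezeLimit_extract D a b hab hρ hsep (fun k => ⟨(hfam k).1, (hfam k).2.1⟩) (fun k => (hfam k).2.2.1.2.2.1)
    (fun k => (hfam k).2.2.1.2.2.2) hgates hq2 hq2' H d β εD hHd hHball hHcl hRεD hcone hexits Pk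
  have hrsd : 2 * rs ≤ dist (D.pt 0) (D.pt 1) := by
    have h1 : rs ≤ η' / 6 := min_le_left _ _
    have h2 : η' ≤ dist (D.pt 0) (D.pt 1) := min_le_right _ _
    linarith
  obtain ⟨Θ⟩ := Λ.outer (rs := rs) (Uf' := Uf') hUf'c.isPreconnected hUf'D
    (fun i => (hUf'disj i).mono_right (closedBall_subset_closedBall hRδ)) hUf'big (by linarith) hrsd (by linarith)
  have hη'η : η' ≤ η := min_le_left _ _
  obtain ⟨Ef, M, φE, Φ, dd, hpt0, hpt1, h6, h7, h8, h9, h10, h11, h19, h20, h21, h22, h31, h32, h33⟩ :=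
    Λ.final_pair Θ (η := η') (sP := sP) hη'0 (min_le_right _ _) hrs0 (min_le_left _ _) (by linarith) hsP hab' hba' H1
      (fun i t ht => H2 i t (ht.trans (by linarith [min_le_right (η' / 6) (r₀ / 2)]))) hε'
  -- the conclusion
  have hP : ∀ i, Λ.E.pt i = ![Λ.P₀, Λ.P₁] i := Fin.forall_fin_two.2 ⟨Λ.hEpt0, Λ.hEpt1⟩
  have hdP : 7 * ρ / 128 ≤ dist (Ef.pt 0) (Ef.pt 1) := by
    rw [hpt0, hpt1]
    have h0 : dist Λ.P₀ (D.pt 0 - Λ.τ) ≤ R := by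
      have := Λ.hPα 0; simp only [Matrix.cons_val_zero] at this; exact this
    have h1 : dist Λ.P₁ (D.pt 1 - Λ.τ) ≤ R := by
      have := Λ.hPα 1; simp only [Matrix.cons_val_one, Matrix.cons_val_zero] at this; exact this
    have hd : dist (D.pt 0 - Λ.τ) (D.pt 1 - Λ.τ) = dist (D.pt 0) (D.pt 1) := dist_sub_right _ _ _
    linarith [dist_triangle (D.pt 0 - Λ.τ) Λ.P₀ (D.pt 1 - Λ.τ), dist_triangle Λ.P₀ Λ.P₁ (D.pt 1 - Λ.τ),
      dist_comm (D.pt 0 - Λ.τ) Λ.P₀, Λ.hsep]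
  refine ⟨fun j => ψ₀ (θ j), Ef, M, Λ.τ, Λ.x, φE, Φ, dd, ρ / 128, ρ / 64, ρ / 128, ρ / 128,
    hψ₀.comp hθ, Λ.santi, Λ.spos, Λ.s0, Λ.hτ, h6, fun t => (h7 t).trans hη'η, h8.trans hη'η, h9.trans hη'η, h10, h11,
    by positivity, by positivity, by positivity, by linarith, le_rfl, le_rfl, by linarith, h19, h20, h21, h22,
    Λ.hq2, Λ.hq2', ?_, ?_, ?_, ?_, ?_, ?_, h31, h32, ?_, Λ.hqdom, Λ.hprob⟩
  · rw [hpt0]; exact Λ.hconv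
  · rw [hpt1]; exact Λ.hconv'
  · intro j; rw [hpt0]; exact Λ.habove j
  · intro j; rw [hpt1]; exact Λ.habove' j
  · rw [hpt0]
    filter_upwards [Λ.hU] with j hj v hv
    exact hj v (ball_subset_ball (by linarith) hv)
  · rw [hpt1]
    filter_upwards [Λ.hU'] with j hj v hv
    exact hj v (ball_subset_ball (by linarith) hv)
  · -- (R) with the rows part
    have hsmall : ∀ᶠ j in atTop, 10 * δ (φ (ψ₀ (θ j))) < ρ / 4 :=
      ((tendsto_order.1 (Λ.s0.mono_right nhdsWithin_le_nhds)).2 (ρ / 40) (by positivity)).mono fun j hj => by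
        have : δ (φ (ψ₀ (θ j))) < ρ / 40 := hj
        linarith
    filter_upwards [h33, Λ.hU, Λ.hU', hsmall] with j hj hUj hUj' hsj w π hπ y hy
    obtain ⟨h1, h2⟩ := hj w π hπ y hy
    refine ⟨h1, h2, fun hre him => ?_, fun hre him => ?_⟩
    · rw [hpt0] at hre him
      have hball : ((δ (φ (ψ₀ (θ j))) : ℝ) : ℂ) * hexCenter y - ((δ (φ (ψ₀ (θ j))) : ℝ) : ℂ) * triEmbed (Λ.x j) ∈ ball Λ.P₀ (ρ / 2) := by
        rw [mem_ball, dist_eq_norm]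
        refine (Complex.norm_le_abs_re_add_abs_im _).trans_lt ?_
        rw [Complex.sub_re, Complex.sub_im]; linarith [hre.le, him.le]
      exact not_lt.1 fun h => hπ y hy ((hUj y hball).2 h)
    · rw [hpt1] at hre him
      have hball : ((δ (φ (ψ₀ (θ j))) : ℝ) : ℂ) * hexCenter y - ((δ (φ (ψ₀ (θ j))) : ℝ) : ℂ) * triEmbed (Λ.x j) ∈ ball Λ.P₁ (ρ / 2) := by
        rw [mem_ball, dist_eq_norm]
        refine (Complex.norm_le_abs_re_add_abs_im _).trans_lt ?_
        rw [Complex.sub_re, Complex.sub_im]; linarith [hre.le, him.le]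
      exact not_lt.1 fun h => hπ y hy ((hUj' y hball).2 h)

/-- **Registered carrier `stub_carvedReduction_domainsCoreF`** (crux item stmt-CriticalPhenomena-10472, stub
T-A′₂F `stub_carvedReduction_squeezeGeometry_domainsCoreF`; the registered statement itself is
`carvedReduction_squeezeGeometry_domainsCoreF` of this file): two distinct marked points are a
positive distance apart. -/
theorem stub_carvedReduction_domainsCoreF : ∀ D : DobrushinDomain, 0 < dist (D.pt 0) (D.pt 1) :=
  fun D => dist_pos.2 fun h => absurd (D.pt_injective h) (by decide)

end Summit.CriticalPhenomena.SAWScalingLimit.Theorems.ObservableToSLE.TypeLadder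

end
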